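import Summits.QuantumFields.QCD.Theses.HeatSlicedQuarks
import Summits.QuantumFields.QCD.Theorems.HeatSlicedQuarksSmallFieldUltracontractivity
import Summits.QuantumFields.QCD.Theorems.HeatSlicedQuarksInterleavedHeatSliceFlowStubParametrixLate

/-!
# Stub `stub_windingRegime` of line `Sketch`
(crux `Summit.QuantumFields.QCD.Theses.HeatSlicedQuarks.InterleavedHeatSliceFlow`, item stmt-QuantumFields-8891)

**Winding regime** (reshape r3; the torus-winding regime of `ParametrixDiagonal`).  For every
`K₀ > 0` there are `ε > 0` and `C` such that, on every torus of side `L`, for every `SU(3)` field `U`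
whose plaquette deficits are GLOBALLY `(ε/r²)²`-small, every mass `m ∈ [-1/2, 1]`, every scale
`1 ≤ r ≤ L` and every proper time `1 ≤ t ≤ r²` with `L² ≤ K₀² t` (the heat slice feels the torus),
every colour–spin entry of the difference of the on-diagonal heat kernels of `H_U = D_W(U)ᴴ D_W(U)`
and of the free `H_1` (`U ≡ 1`) obeys

  `|e^{-tH_U}((x,a,α),(x,b,β)) − e^{-tH_1}((x,a,α),(x,b,β))| ≤ C e^{-L²/t} / t²`.

Proof.  No cancellation between the two kernels is needed in this regime.  The closed sibling crux
`SmallFieldUltracontractivity` (item 8871, theorem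
`Cruxes.SmallFieldUltracontractivity.PointCentredAxialParabolic.SmallFieldUltracontractivity_of`),
applied to `U` (global smallness implies smallness on every `K·r`-ball) and to `U ≡ 1` (zero
deficits), bounds EACH kernel entry by `C₀/t²`; this triangle-inequality step is the landed theorem
`stub_parametrixLate` of this namespace (constant `C₁ = 2C₀`, uniform in `1 ≤ t ≤ r²`).  In the
winding regime `L²/t ≤ K₀²`, so `1 ≤ e^{K₀²} e^{-L²/t}` and hence
`C₁/t² ≤ max(C₁,0) e^{K₀²} · e^{-L²/t}/t²`: the stub holds with the same `ε` and
`C := max(C₁,0) e^{K₀²}`.  Leans on: `stub_parametrixLate` (landed; itself 8871 applied twice),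
Mathlib.
-/

namespace Summit.QuantumFields.QCD.Cruxes.InterleavedHeatSliceFlow.Sketch

open Literature.MathematicalPhysics.QuantumLattice Literature.MathematicalPhysics.QuantumFieldTheory
  Literature.Probability.LatticeModels
open Summit.QuantumFields.QCD.Theses.HeatSlicedQuarks
open scoped Matrix

/-- The real-number bookkeeping of the winding regime: if `0 < t` and `L₂ ≤ K₀² t`, then
`C/t² ≤ max(C,0) · e^{K₀²} · e^{-L₂/t} / t²` (because `L₂/t ≤ K₀²` gives
`1 ≤ e^{K₀² - L₂/t} = e^{K₀²} e^{-L₂/t}`, and `C ≤ max(C,0)` with `0 ≤ max(C,0)`). -/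
private theorem windingRegime_const_le {K₀ C t L₂ : ℝ} (ht : 0 < t) (hL : L₂ ≤ K₀ ^ 2 * t) :
    C / t ^ 2 ≤ max C 0 * Real.exp (K₀ ^ 2) * Real.exp (-(L₂ / t)) / t ^ 2 := by
  have ht2 : 0 < t ^ 2 := by positivity
  refine div_le_div_of_nonneg_right ?_ ht2.le
  have hexp : 1 ≤ Real.exp (K₀ ^ 2) * Real.exp (-(L₂ / t)) := by
    rw [← Real.exp_add]
    refine Real.one_le_exp ?_
    have hdiv : L₂ / t ≤ K₀ ^ 2 := by rwa [div_le_iff₀ ht]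
    linarith
  have hM0 : 0 ≤ max C 0 := le_max_right _ _
  calc C ≤ max C 0 * 1 := by rw [mul_one]; exact le_max_left _ _
    _ ≤ max C 0 * (Real.exp (K₀ ^ 2) * Real.exp (-(L₂ / t))) := mul_le_mul_of_nonneg_left hexp hM0
    _ = max C 0 * Real.exp (K₀ ^ 2) * Real.exp (-(L₂ / t)) := (mul_assoc _ _ _).symm

/-- **Winding regime** (registered stub `stub_windingRegime` of line `Sketch`, reshape r3; the
torus-winding regime `L² ≤ K₀² t` of `ParametrixDiagonal`): for every `K₀ > 0` there are `ε > 0` and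
`C` such that under global `(ε/r²)²`-smallness of the plaquette deficits of `U`, for `m ∈ [-1/2, 1]`,
`1 ≤ r ≤ L`, `1 ≤ t ≤ r²` with `L² ≤ K₀² t`, and all `x, a, b, α, β`,
`|e^{-tH_U}((x,a,α),(x,b,β)) − e^{-tH_1}((x,a,α),(x,b,β))| ≤ C e^{-L²/t}/t²`.
Proof: `stub_parametrixLate` (the closed crux 8871 applied to `U` and to `U ≡ 1`, triangle
inequality) gives `ε` and a bound `C₁/t²`; in the winding regime `1 ≤ e^{K₀²} e^{-L²/t}`, so
`C := max(C₁,0) e^{K₀²}` works (`windingRegime_const_le`).  The hypothesis `0 < K₀` is not needed. -/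
theorem stub_windingRegime :
    ∀ K₀ : ℝ, 0 < K₀ → ∃ ε : ℝ, 0 < ε ∧ ∃ C : ℝ, ∀ (L : ℕ) [NeZero L]
      (U : GaugeConfig 4 L (Matrix.specialUnitaryGroup (Fin 3) ℂ)) (m : ℝ), m ∈ Set.Icc (-(1 / 2 : ℝ)) 1 →
      ∀ (r : ℕ), 1 ≤ r → r ≤ L →
      (∀ (y : TorusSite 4 L) (μ ν : Fin 4),
        3 - ((fundamentalRep (Fin 3)) (plaquetteHolonomy U y μ ν)).trace.re ≤ (ε / (r : ℝ) ^ 2) ^ 2) →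
      ∀ (t : ℝ), 1 ≤ t → t ≤ (r : ℝ) ^ 2 → (L : ℝ) ^ 2 ≤ K₀ ^ 2 * t →
      ∀ (x : TorusSite 4 L) (a b : Fin 3) (α β : Fin 4),
        ‖(NormedSpace.exp (-(t : ℂ) • ((wilsonDirac (fundamentalRep (Fin 3)) U m 1)ᴴ *
              wilsonDirac (fundamentalRep (Fin 3)) U m 1))) (x, a, α) (x, b, β) -
            (NormedSpace.exp (-(t : ℂ) •
              ((wilsonDirac (fundamentalRep (Fin 3))
                  (fun _ : Edge 4 L => (1 : Matrix.specialUnitaryGroup (Fin 3) ℂ)) m 1)ᴴ *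
                wilsonDirac (fundamentalRep (Fin 3))
                  (fun _ : Edge 4 L => (1 : Matrix.specialUnitaryGroup (Fin 3) ℂ)) m 1))) (x, a, α) (x, b, β)‖ ≤
          C * Real.exp (-((L : ℝ) ^ 2 / t)) / t ^ 2 := by
  intro K₀ _
  obtain ⟨ε, hε, C₁, hC₁⟩ := stub_parametrixLate
  refine ⟨ε, hε, max C₁ 0 * Real.exp (K₀ ^ 2), ?_⟩
  intro L _ U m hm r hr hrL hsmall t ht htr hLt x a b α β
  exact (hC₁ L U m hm r hr hrL hsmall t ht htr x a b α β).trans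
    (windingRegime_const_le (lt_of_lt_of_le one_pos ht) hLt)

end Summit.QuantumFields.QCD.Cruxes.InterleavedHeatSliceFlow.Sketch
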